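import Summits.QuantumAdvantage.QuantumAdvantage.Theorems.SymplecticPurityNoFreeFrameCoord

/-!
# Crux `DeqThesis`, line `Sketch` — stub `stub_bridge`: field-level ⇒ family-level local flatness

The field-level statement `CubeLocallyFlat'` of the line (the normalised cube graph state
`2^{-n/2} Σ_y |y⟩|e((e⁻¹ y)³)⟩` on `n + n` qubits is `2^{-δ n}`-flat against every locally rotated Pauli
string `⊗ᵢ uᵢ σ_{Sᵢ} uᵢ†`, `S ≠ I`, for every field `K` of order `2ⁿ`, every `n ≥ n₀` and every additive
identification `e : K ≃+ 𝔽₂ⁿ`) implies the same flatness, with the same rate `δ`, for the actual final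
states of the uniform witness family `cubeFamily` (`Theorems/SymplecticPurityDefs.lean`) on the inputs
`0ⁿ` of the good lengths `n = 2·3^k` — in particular on inputs of unbounded length.

Proof: on `0ⁿ` the final state of `cubeFamily` is the normalised graph state of the Boolean map
`cubeMap n` (`cubeFamily_stateAfter`), and for `n = 2·3^k` this map is the cube of the field
`K = 𝔽₂[X]/(Φ_{3^{k+1}})` (`fact_irreducible_cubePoly`, `card_cubeField`) read through the power-basis
coordinates `cubeEquiv k` (`cubeMap_eq_cube`), transported along the propositional equality
`|0ⁿ| = 2·3^k` (`exists_cubeMap_eq_cube`); the amplitudes agree by `invSqrt2 ^ n = (√2ⁿ)⁻¹`.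
-/

noncomputable section

set_option linter.dupNamespace false -- D-0017: single-problem summit ⇒ `QuantumAdvantage.QuantumAdvantage` by design

namespace Summit.QuantumAdvantage.QuantumAdvantage.Theorems.SymplecticPurity

open Matrix Finset Literature.Computability.QuantumComplexity Literature.Computability.Cryptography
  Literature.Barriers.QuantumAdvantage

/-- Transport of `cubeMap_eq_cube` along `2·3^k = m`: `cubeMap m` is the cube map of
`𝔽₂[X]/(Φ_{3^{k+1}})` in some additive coordinates `e : 𝔽₂[X]/(Φ_{3^{k+1}}) ≃+ 𝔽₂^m`. -/
theorem exists_cubeMap_eq_cube (k : ℕ) {m : ℕ} (h : 2 * 3 ^ k = m) :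
    ∃ e : AdjoinRoot (cubePoly k) ≃+ (Fin m → ZMod 2), ∀ y : Fin m → Bool,
      cubeMap m y = fun l => decide (e ((e.symm fun i => if y i then 1 else 0) ^ 3) l = 1) := by
  subst h
  exact ⟨cubeEquiv k, cubeMap_eq_cube k⟩

/-- The amplitude of the Hadamard layer: `invSqrt2 ^ n = (√2ⁿ)⁻¹`. -/
theorem invSqrt2_pow_eq_inv_pow (n : ℕ) : invSqrt2 ^ n = ((Real.sqrt 2 : ℂ) ^ n)⁻¹ := by
  rw [show (invSqrt2 : ℂ) = ((Real.sqrt 2 : ℂ))⁻¹ from one_div _, inv_pow]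

/-- `n ≤ 2·3ⁿ`: good input lengths are unbounded. -/
theorem le_two_mul_three_pow (n : ℕ) : n ≤ 2 * 3 ^ n :=
  (Nat.lt_pow_self (by norm_num : 1 < 3)).le.trans (Nat.le_mul_of_pos_left _ (by norm_num))

/-- **Stub `stub_bridge` of line `Sketch` (crux `DeqThesis`)**: the field-level local flatness
`CubeLocallyFlat'` of the normalised cube graph state (all fields of order `2ⁿ`, all additive
coordinates, vacuous regime `True`) implies the family-level local flatness of `cubeFamily` at the same
rate on inputs of unbounded length (the inputs `0ⁿ`, `n = 2·3^k`, after all gates). -/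
theorem stub_bridge :
    (∃ δ : ℝ, 0 < δ ∧ ∃ n₀ : ℕ, ∀ n ≥ n₀, ∀ (K : Type) [Field K] [Fintype K], Fintype.card K = 2 ^ n →
      ∀ e : K ≃+ (Fin n → ZMod 2),
      ∀ u : Fin (n + n) → Matrix Bool Bool ℂ, (∀ i, u i ∈ Matrix.unitaryGroup Bool ℂ) →
        ∀ S : Fin (n + n) → Pauli, S ≠ (fun _ => Pauli.I) → True →
          ‖star (fun w : QReg (n + n) =>
                if (fun j : Fin n => w (Fin.natAdd n j)) =
                    (fun j : Fin n => decide (e ((e.symm (fun i : Fin n => if w (Fin.castAdd n i) then 1 else 0)) ^ 3) j = 1))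
                then ((Real.sqrt 2 ^ n)⁻¹ : ℂ) else 0) ⬝ᵥ
              (tensorAll (fun i => u i * (S i).mat * star (u i))).mulVec
                (fun w : QReg (n + n) =>
                  if (fun j : Fin n => w (Fin.natAdd n j)) =
                      (fun j : Fin n => decide (e ((e.symm (fun i : Fin n => if w (Fin.castAdd n i) then 1 else 0)) ^ 3) j = 1))
                  then ((Real.sqrt 2 ^ n)⁻¹ : ℂ) else 0)‖
            ≤ (2 : ℝ) ^ (-(δ * (n : ℝ)))) →
    ∃ δ : ℝ, 0 < δ ∧ ∀ n₀ : ℕ, ∃ x : List Bool, n₀ ≤ x.length ∧ ∃ j : ℕ,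
      ∀ u : Fin (x.length + cubeFamily.ancillas x.length) → Matrix Bool Bool ℂ,
        (∀ i, u i ∈ Matrix.unitaryGroup Bool ℂ) →
        ∀ S : Fin (x.length + cubeFamily.ancillas x.length) → Pauli, S ≠ (fun _ => Pauli.I) →
          ‖star (cubeFamily.stateAfter x j) ⬝ᵥ
              (tensorAll (fun i => u i * (S i).mat * star (u i))).mulVec (cubeFamily.stateAfter x j)‖
            ≤ (2 : ℝ) ^ (-(δ * (x.length : ℝ))) := by
  rintro ⟨δ, hδ, n₀, H⟩
  refine ⟨δ, hδ, fun n₀' => ?_⟩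
  -- a good input length `2·3^k ≥ max n₀ n₀'` and the all-zero input of that length
  set k : ℕ := max n₀ n₀' with hkdef
  have hk : max n₀ n₀' ≤ 2 * 3 ^ k := le_two_mul_three_pow _
  obtain ⟨x, hxlen, hx⟩ : ∃ x : List Bool, x.length = 2 * 3 ^ k ∧ ∀ i, x.get i = false :=
    ⟨List.replicate (2 * 3 ^ k) false, List.length_replicate, fun i => by simp⟩
  have hn : 0 < x.length := by rw [hxlen]; positivity
  refine ⟨x, ?_, (cubeGates x.length).length, fun u hu S hS => ?_⟩
  · rw [hxlen]; exact (le_max_right _ _).trans hk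
  -- the field `K = 𝔽₂[X]/(Φ_{3^{k+1}})` of order `2^{|x|}` and its transported power coordinates
  haveI : Fact (Irreducible (cubePoly k)) := fact_irreducible_cubePoly k
  letI : Fintype (AdjoinRoot (cubePoly k)) := Fintype.ofEquiv _ (cubeEquiv k).symm.toEquiv
  have hcard : Fintype.card (AdjoinRoot (cubePoly k)) = 2 ^ x.length := by rw [card_cubeField, hxlen]
  obtain ⟨e, he⟩ := exists_cubeMap_eq_cube k hxlen.symm
  have hge : x.length ≥ n₀ := by rw [hxlen]; exact (le_max_left _ _).trans hk
  have key := H x.length hge (AdjoinRoot (cubePoly k)) hcard e u hu S hS trivial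
  -- the final state of the family on `0^{|x|}` is the field-level cube graph state
  have hstate : cubeFamily.stateAfter x (cubeGates x.length).length =
      fun w : QReg (x.length + x.length) =>
        if (fun j : Fin x.length => w (Fin.natAdd x.length j)) =
            (fun j : Fin x.length => decide (e ((e.symm (fun i : Fin x.length =>
              if w (Fin.castAdd x.length i) then 1 else 0)) ^ 3) j = 1))
        then ((Real.sqrt 2 ^ x.length)⁻¹ : ℂ) else 0 := by
    rw [cubeFamily_stateAfter x hx hn]
    funext w
    rw [he, invSqrt2_pow_eq_inv_pow]
  rw [hstate]
  exact key

end Summit.QuantumAdvantage.QuantumAdvantage.Theorems.SymplecticPurity
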